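import Summits.QuantumAdvantage.QuantumAdvantage.Theorems.CubicForrelationNearExactIsExactTwelveLevelSix941
import Summits.QuantumAdvantage.QuantumAdvantage.Theorems.CubicForrelationNearExactIsExactTwelveClosed943

/-!
# Crux `CubicForrelation.NearExactIsExact` (stmt-QuantumAdvantage-14043) — n = 12: the window `[941/1024, 943/1024)` is EMPTY too;
  `Φ ≥ 941/1024 ⇒ Φ = 1` (closed), `θ₁₂ ∈ [57/64, 941/1024)`

Certificate seat `b2b-cforr-cert` (gen 15).  HONEST FRAMING: a kernel-checked DECIDABLE VERDICT (standard axioms, no `decide`/`native_decide`)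
about the finite slice `n = 12` of the crux — NOT summit progress (the crux asks for ONE `θ < 1` uniform in `n`; nothing here is uniform).

Two rungs below `…TwelveClosed943` (`Φ ≥ 943/1024 ⇒ Φ = 1`): type O has `Φ ≤ 940/1024` (`to15_typeO_le_940`: no cubic weight in `(768, 816]`),
level 5 is dead above `932/1024` (`tw15_levelFive_932_false`), level `≥ 6` is dead on `[941/1024, 59/64)` (`tw15_levelSix_941_false`: budget `664`,
the last one gen 13's engine tolerates).  Hence `θ₁₂ ∈ [57/64, 941/1024) = [912/1024, 941/1024)`; the candidates shrink to `913/1024 … 940/1024`.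

References: J. Ax (1964) / R. J. McEliece (1972); T. Kasami, N. Tokura (1970); MacWilliams–Sloane (1977) Ch. 13–15; C. Carlet (2021) §5.2;
R. O'Donnell (2014) §3.3.  Everything below is proved from Mathlib and the tree; axioms are the standard three.
-/

set_option linter.dupNamespace false -- D-0017: single-problem summit ⇒ `QuantumAdvantage.QuantumAdvantage` by design

noncomputable section

namespace Summit.QuantumAdvantage.QuantumAdvantage.Theorems.CubicForrelation.NearExactIsExact

open Finset
open Literature.Computability.QuantumComplexity
open Literature.Computability.QuantumComplexity.DerivativeWalsh (W)

/-! ### The window `[941/1024, 59/64)` is empty -/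

/-- **No cubic pair on `6 + 6` bits has `941/1024 ≤ Φ < 59/64`**: by the Ax level of `g` — type O (`to15_typeO_le_940`), level 5
(`tw15_levelFive_932_false`), level `≥ 6` (`tw15_levelSix_941_false`). NOT summit progress. [this work] -/
theorem tw15_window_941_false (f g : (Fin (6 + 6) → Bool) → Bool) (hf : IsDegLeFun 3 f) (hg : IsDegLeFun 3 g)
    (hlo : (941 / 1024 : ℝ) ≤ forrelation f g) (hhi : forrelation f g < 59 / 64) : False := by
  obtain ⟨u, hu⟩ := tw_base (n := 6 + 6) g hg 4 (by norm_num)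
  by_cases hO : ∃ x, Odd (u x)
  · have h := to15_typeO_le_940 f g hf hg u hu hO
    linarith
  push Not at hO
  have hu' : ∀ x, W (fun y => signOf (g y)) x = (2 : ℝ) ^ 5 * (((u x / 2 : ℤ)) : ℝ) := fun x => by
    rw [tw_level_up g u hu hO x]
  by_cases h5 : ∃ x, Odd (u x / 2)
  · exact tw15_levelFive_932_false f g hf hg (fun x => u x / 2) hu' h5 (by linarith)
  push Not at h5
  have hu'' : ∀ x, W (fun y => signOf (g y)) x = (2 : ℝ) ^ 6 * (((u x / 2 / 2 : ℤ)) : ℝ) := fun x => by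
    rw [tw_level_up (j := 5) g (fun x => u x / 2) hu' h5 x]
  exact tw15_levelSix_941_false f g hf hg (fun x => u x / 2 / 2) hu'' hlo hhi

/-- **Closed isolation at `941/1024` on `6 + 6` bits**: `Φ ≥ 941/1024 ⇒ Φ = 1` for cubic pairs (the empty window, then `isolation ≥ 59/64`).
NOT summit progress. [this work] -/
theorem tw15_isolation_ge_941 (f g : (Fin (6 + 6) → Bool) → Bool) (hf : IsDegLeFun 3 f) (hg : IsDegLeFun 3 g)
    (hΦ : (941 / 1024 : ℝ) ≤ forrelation f g) : forrelation f g = 1 := by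
  by_cases h : (59 / 64 : ℝ) ≤ forrelation f g
  · exact tw15_isolation_ge_5964 f g hf hg h
  · exact (tw15_window_941_false f g hf hg hΦ (lt_of_not_ge h)).elim

/-! ### Packaging at the literal type `Fin 12` -/

/-- **`Φ ≥ 941/1024 ⇒ Φ = 1`** for cubic pairs on `Fin 12` (closed isolation three rungs below `59/64`). NOT summit progress. [this work] -/
theorem isolation_twelve_ge_941 : ∀ f g : (Fin 12 → Bool) → Bool, IsDegLeFun 3 f → IsDegLeFun 3 g →
    (941 / 1024 : ℝ) ≤ forrelation f g → forrelation f g = 1 :=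
  fun f g hf hg h => tw15_isolation_ge_941 f g hf hg h

/-- **`θ₁₂ < 941/1024`**, indeed `θ₁₂ ∈ [57/64, 941/1024)`: the least isolation threshold for cubic pairs on 12 bits is at least the record
`57/64 = 912/1024` (`theta_twelve_bounds`) and STRICTLY below `941/1024` (closed isolation + `fb_theta_lt_of_closed`).  The tree had
`θ₁₂ < 943/1024` (`theta_twelve_halfopen_943`). NOT summit progress. [this work] -/
theorem theta_twelve_halfopen_941 : ∃ θ₀ : ℝ, 57 / 64 ≤ θ₀ ∧ θ₀ < 941 / 1024 ∧
    IsLeast {θ : ℝ | ∀ f g : (Fin 12 → Bool) → Bool, IsDegLeFun 3 f → IsDegLeFun 3 g →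
      θ < forrelation f g → forrelation f g = 1} θ₀ := by
  obtain ⟨θ₀, hθ₀⟩ := theta_exists 12
  obtain ⟨θ, hθlt, hθ⟩ := fb_theta_lt_of_closed (n := 12) (941 / 1024) isolation_twelve_ge_941
  exact ⟨θ₀, theta_twelve_bounds.2 θ₀ hθ₀.1, lt_of_le_of_lt (hθ₀.2 hθ) hθlt, hθ₀⟩

/-- **No cubic pair on 12 bits has `941/1024 ≤ Φ < 1`.** NOT summit progress. [this work] -/
theorem no_window_twelve_ge_941 : ¬ ∃ f g : (Fin 12 → Bool) → Bool, IsDegLeFun 3 f ∧ IsDegLeFun 3 g ∧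
    (941 / 1024 : ℝ) ≤ forrelation f g ∧ forrelation f g < 1 := by
  rintro ⟨f, g, hf, hg, hle, hlt⟩
  have h := isolation_twelve_ge_941 f g hf hg hle
  linarith

end Summit.QuantumAdvantage.QuantumAdvantage.Theorems.CubicForrelation.NearExactIsExact

end
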